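import Summits.NavierStokesRegularity.NavierStokesRegularity.Theorems.TypeIIInviscidRelaxationAxisymSwirlRegularBarrierWall
import Mathlib.Analysis.SpecialFunctions.Log.Deriv
import HarnessLib

/-!
# The critical sink: exact steady swirl profiles at inflow Reynolds number `2` with no uniform rate at the axis

Helper toward the crux `AxisymSwirlRegular` (stmt-NavierStokesRegularity-1964, route TypeIIInviscidRelaxation),
registered line `radial_inflow_split`, criterion stub `stub_oneSidedRadialCriterion` (⟨19059⟩: `r u_r ≥ −Cν` on an
axis tube ⇒ continuation; open half `C ≥ 2`).

Why the landed machinery stops at `C = 2` (`RadialInflowBarrierWall.exists_isTubeBarrier_iff_lt_two`, the static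
class; `RadialInflowBarrierWallT.not_exists_halfLineBarrier_of_two_le`, the time-dependent class): in the swirl
equation `Γ_t + u_r Γ_r + u_z Γ_z = ν(Γ_rr − Γ_r/r + Γ_zz)` the radial part `νΓ_rr − (ν + r u_r)Γ_r/r` is the
generator of a Bessel process of dimension `d = −r u_r/ν`; under `r u_r = −Cν` the axis absorbs swirl iff `d = C < 2`.
This file exhibits the mechanism by EXACT SOLUTIONS of the linear swirl equation (reduced variables, viscosity `1`):
for every core radius `ε > 0` the smooth, divergence-free, axisymmetric «regularised sink with axial ventilation»

  `b_r(r) = −2r/(r² + ε²)`,  `b_z(r,z) = 4ε² z/(r² + ε²)²`  (`(1/r)∂_r(r b_r) + ∂_z b_z = 0`),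

has inflow Reynolds number `−r b_r = 2r²/(r²+ε²) < 2` EVERYWHERE (the stub's gate at the critical constant, strictly),
and transports the STEADY swirl profile

  `Γ_ε(r) = log(1 + r²/ε²)`,  `Γ_ε'' − Γ_ε'/r + (2r/(r²+ε²)) Γ_ε' = 0`,

smooth, vanishing (quadratically) on the axis, increasing — yet `Γ_ε(r)/Γ_ε(1) → 1` as `ε → 0⁺` for every fixed
`0 < r` (`tendsto_sinkSwirl_ratio`): the normalised profiles concentrate at the axis with NO modulus of vanishing
uniform in `ε` (`not_uniform_modulus`).  So no argument whose only inputs are the swirl equation, incompressibility and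
smoothness of the drift, `0 ≤ Γ ≤ 1`, `Γ(0,t) = 0`, and the one-sided bound `r u_r > −2ν` can produce a rate at the
axis — the conclusion every comparison/Hölder route to ⟨19059⟩ needs (`ChenFangZhang2017.holderSwirl_regularity`,
Wei's log modulus) is false in that linear class at `C = 2`.  (For `C < 2` the same construction,
`Γ' = r(r²+ε²)^{−C/2}`, converges to the tree's power barrier `r^{2−C}`: the exponent of
`RadialInflowBarrierWall.rpow_isTubeBarrier_of_lt_two` is attained.)

Contents: `sinkGate_bounds` (the one-sided gate `−2 < r b_r ≤ 0`), `sinkDrift_divFree` (incompressibility of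
`(b_r, b_z)`), `hasDerivAt_sinkSwirl` / `hasDerivAt_deriv_sinkSwirl` / `sinkSwirl_pde` (the steady swirl equation,
in the clause shape `w'' − w'/r + E w' = 0` of the tree's barrier classes with `E = −b_r`), `sinkSwirl_zero` /
`sinkSwirl_pos` / `sinkSwirl_strictMonoOn`, `tendsto_sinkSwirl_ratio`, `not_uniform_modulus`.

Model-tightness certificate for the LOCAL LINEAR theory only: the drifts `b^ε` are not Navier–Stokes solutions and
have infinite energy (`b_z ∼ z`); nothing here bears on the truth of the stub, and nothing here proves
`AxisymSwirlRegular` or NavierStokesRegularity.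

References: the swirling sink / bathtub-vortex family `u_θ ∝ r^{1−R}` (sink Reynolds number `R`; critical `R = 2`):
P. G. Drazin, N. Riley, *The Navier–Stokes equations: a classification of flows and exact solutions*, CUP 2006, §2.4;
W. Feller, Ann. of Math. 55 (1952) (Bessel process of dimension `≥ 2` does not hit the origin). [folklore]
-/

noncomputable section

set_option linter.dupNamespace false

open Set Filter Topology

namespace Summit.NavierStokesRegularity.NavierStokesRegularity.Theorems.RadialInflowCriticalSink

/-! ## §1 The regularised critical sink drift -/

/-- **The one-sided gate at the critical constant, strictly.** For the sink drift `b_r(r) = −2r/(r²+ε²)`: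
`−2 < r·b_r(r) ≤ 0` for every `r` (inflow Reynolds number `2r²/(r²+ε²) < 2`). [folklore] -/
theorem sinkGate_bounds {ε : ℝ} (hε : 0 < ε) (r : ℝ) :
    -2 < r * (-(2 * r) / (r ^ 2 + ε ^ 2)) ∧ r * (-(2 * r) / (r ^ 2 + ε ^ 2)) ≤ 0 := by
  have hden : 0 < r ^ 2 + ε ^ 2 := by positivity
  have h1 : r * (-(2 * r) / (r ^ 2 + ε ^ 2)) = -(2 * r ^ 2 / (r ^ 2 + ε ^ 2)) := by ring
  rw [h1]
  constructor
  · have h2 : 2 * r ^ 2 / (r ^ 2 + ε ^ 2) < 2 := by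
      rw [div_lt_iff₀ hden]; nlinarith [sq_nonneg r, pow_pos hε 2]
    linarith
  · have h2 : 0 ≤ 2 * r ^ 2 / (r ^ 2 + ε ^ 2) := by positivity
    linarith

/-- **Incompressibility of the sink-with-ventilation drift** `b = b_r e_r + b_z e_z`, `b_r = −2r/(r²+ε²)`,
`b_z = 4ε²z/(r²+ε²)²`: in reduced variables `div b = (1/r)∂_r(r b_r) + ∂_z b_z`, and
`∂_r(r b_r) = −4ε²r/(r²+ε²)²`, `∂_z b_z = 4ε²/(r²+ε²)²`, so `div b = 0` off the axis. [folklore] -/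
theorem sinkDrift_divFree {ε : ℝ} (hε : 0 < ε) {r : ℝ} (hr : r ≠ 0) (z : ℝ) :
    HasDerivAt (fun ρ : ℝ => ρ * (-(2 * ρ) / (ρ ^ 2 + ε ^ 2))) (-(4 * ε ^ 2 * r) / (r ^ 2 + ε ^ 2) ^ 2) r ∧
    HasDerivAt (fun ζ : ℝ => 4 * ε ^ 2 * ζ / (r ^ 2 + ε ^ 2) ^ 2) (4 * ε ^ 2 / (r ^ 2 + ε ^ 2) ^ 2) z ∧
    r⁻¹ * (-(4 * ε ^ 2 * r) / (r ^ 2 + ε ^ 2) ^ 2) + 4 * ε ^ 2 / (r ^ 2 + ε ^ 2) ^ 2 = 0 := by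
  have hden : 0 < r ^ 2 + ε ^ 2 := by positivity
  refine ⟨?_, ?_, ?_⟩
  · -- `ρ ↦ ρ · (−2ρ/(ρ²+ε²)) = −2 · (ρ²/(ρ²+ε²))`
    have hsq : HasDerivAt (fun ρ : ℝ => ρ ^ 2) (2 * r) r := by simpa using hasDerivAt_pow 2 r
    have hd : HasDerivAt (fun ρ : ℝ => ρ ^ 2 + ε ^ 2) (2 * r) r := by
      simpa using (hasDerivAt_pow 2 r).add_const (ε ^ 2)
    have h := (hsq.div hd hden.ne').const_mul (-2)
    have heq : (fun ρ : ℝ => ρ * (-(2 * ρ) / (ρ ^ 2 + ε ^ 2))) = fun ρ => -2 * (ρ ^ 2 / (ρ ^ 2 + ε ^ 2)) := by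
      funext ρ; ring
    rw [heq]
    refine h.congr_deriv ?_
    field_simp
    ring
  · have h := (hasDerivAt_id z).const_mul (4 * ε ^ 2 / (r ^ 2 + ε ^ 2) ^ 2)
    have heq : (fun ζ : ℝ => 4 * ε ^ 2 * ζ / (r ^ 2 + ε ^ 2) ^ 2)
        = fun ζ => 4 * ε ^ 2 / (r ^ 2 + ε ^ 2) ^ 2 * id ζ := by
      funext ζ; simp only [id]; ring
    rw [heq]
    simpa using h
  · field_simp
    ring

/-! ## §2 The steady swirl profile `Γ_ε(r) = log(1 + r²/ε²)` -/

/-- First derivative of the sink swirl: `Γ_ε'(r) = 2r/(r²+ε²)`. [folklore] -/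
theorem hasDerivAt_sinkSwirl {ε : ℝ} (hε : 0 < ε) (r : ℝ) :
    HasDerivAt (fun ρ : ℝ => Real.log (1 + ρ ^ 2 / ε ^ 2)) (2 * r / (r ^ 2 + ε ^ 2)) r := by
  have hε2 : 0 < ε ^ 2 := pow_pos hε 2
  have hpos : 0 < 1 + r ^ 2 / ε ^ 2 := by positivity
  have hin : HasDerivAt (fun ρ : ℝ => 1 + ρ ^ 2 / ε ^ 2) (2 * r / ε ^ 2) r := by
    have h := ((hasDerivAt_pow 2 r).div_const (ε ^ 2)).const_add 1
    simpa using h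
  refine (hin.log hpos.ne').congr_deriv ?_
  field_simp
  ring

/-- Second derivative of the sink swirl: `Γ_ε''(r) = 2(ε² − r²)/(r²+ε²)²`. [folklore] -/
theorem hasDerivAt_deriv_sinkSwirl {ε : ℝ} (hε : 0 < ε) (r : ℝ) :
    HasDerivAt (fun ρ : ℝ => 2 * ρ / (ρ ^ 2 + ε ^ 2)) (2 * (ε ^ 2 - r ^ 2) / (r ^ 2 + ε ^ 2) ^ 2) r := by
  have hden : 0 < r ^ 2 + ε ^ 2 := by positivity
  have hnum : HasDerivAt (fun ρ : ℝ => 2 * ρ) 2 r := by simpa using (hasDerivAt_id r).const_mul 2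
  have hd : HasDerivAt (fun ρ : ℝ => ρ ^ 2 + ε ^ 2) (2 * r) r := by
    simpa using (hasDerivAt_pow 2 r).add_const (ε ^ 2)
  refine (hnum.div hd hden.ne').congr_deriv ?_
  field_simp
  ring

/-- `deriv` and `iteratedDeriv 2` of the sink swirl. [folklore] -/
theorem deriv_sinkSwirl {ε : ℝ} (hε : 0 < ε) (r : ℝ) :
    deriv (fun ρ : ℝ => Real.log (1 + ρ ^ 2 / ε ^ 2)) r = 2 * r / (r ^ 2 + ε ^ 2) ∧
    iteratedDeriv 2 (fun ρ : ℝ => Real.log (1 + ρ ^ 2 / ε ^ 2)) r = 2 * (ε ^ 2 - r ^ 2) / (r ^ 2 + ε ^ 2) ^ 2 := by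
  refine ⟨(hasDerivAt_sinkSwirl hε r).deriv, ?_⟩
  have hd : deriv (fun ρ : ℝ => Real.log (1 + ρ ^ 2 / ε ^ 2)) = fun ρ => 2 * ρ / (ρ ^ 2 + ε ^ 2) := by
    funext ρ; exact (hasDerivAt_sinkSwirl hε ρ).deriv
  rw [show (2 : ℕ) = 1 + 1 from rfl, iteratedDeriv_succ, iteratedDeriv_one, hd]
  exact (hasDerivAt_deriv_sinkSwirl hε r).deriv

/-- **The steady swirl equation at the critical sink.** `Γ_ε = log(1 + r²/ε²)` solves, for every `r ≠ 0`,
`Γ'' − Γ'/r + E_ε Γ' = 0` with the inflow envelope `E_ε(r) = −b_r(r) = 2r/(r²+ε²)` — the clause shape of the tree's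
barrier classes (`ScenarioCensus.LogGate.IsTubeBarrier`, the `hpde` clause of
`RadialInflowComparisonT.hasSmoothExtensionPast_of_timeDependentBarrier_visc`) with equality and no time
dependence: an exact steady solution of the linear swirl equation `b·∇Γ = Γ_rr − Γ_r/r + Γ_zz` (viscosity `1`,
`Γ` independent of `z`). [folklore: swirling sink flow] -/
theorem sinkSwirl_pde {ε : ℝ} (hε : 0 < ε) {r : ℝ} (hr : r ≠ 0) :
    iteratedDeriv 2 (fun ρ : ℝ => Real.log (1 + ρ ^ 2 / ε ^ 2)) r
      - r⁻¹ * deriv (fun ρ : ℝ => Real.log (1 + ρ ^ 2 / ε ^ 2)) r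
      + (2 * r / (r ^ 2 + ε ^ 2)) * deriv (fun ρ : ℝ => Real.log (1 + ρ ^ 2 / ε ^ 2)) r = 0 := by
  obtain ⟨h1, h2⟩ := deriv_sinkSwirl hε r
  have hden : 0 < r ^ 2 + ε ^ 2 := by positivity
  rw [h1, h2]
  field_simp
  ring

/-- The sink swirl vanishes on the axis. -/
theorem sinkSwirl_zero (ε : ℝ) : Real.log (1 + (0 : ℝ) ^ 2 / ε ^ 2) = 0 := by simp

/-- The sink swirl is positive off the axis. -/
theorem sinkSwirl_pos {ε : ℝ} (hε : 0 < ε) {r : ℝ} (hr : r ≠ 0) : 0 < Real.log (1 + r ^ 2 / ε ^ 2) := by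
  have h : 0 < r ^ 2 / ε ^ 2 := by positivity
  exact Real.log_pos (by linarith)

/-- The sink swirl is strictly increasing in `r ≥ 0`. -/
theorem sinkSwirl_strictMonoOn {ε : ℝ} (hε : 0 < ε) :
    StrictMonoOn (fun ρ : ℝ => Real.log (1 + ρ ^ 2 / ε ^ 2)) (Ici 0) := by
  intro a ha b hb hab
  have hε2 : 0 < ε ^ 2 := pow_pos hε 2
  have ha0 : (0 : ℝ) ≤ a := ha
  have h1 : 0 < 1 + a ^ 2 / ε ^ 2 := by positivity
  have h2 : a ^ 2 / ε ^ 2 < b ^ 2 / ε ^ 2 := by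
    exact div_lt_div_of_pos_right (by nlinarith) hε2
  exact Real.log_lt_log h1 (by linarith)

/-- The sink swirl is smooth (it is a smooth function of `r²`, so `Γ_ε(cylRadius ·)` is the swirl of a smooth
axisymmetric field). -/
theorem contDiff_sinkSwirl {ε : ℝ} (hε : 0 < ε) {n : WithTop ℕ∞} :
    ContDiff ℝ n (fun ρ : ℝ => Real.log (1 + ρ ^ 2 / ε ^ 2)) := by
  have h : ContDiff ℝ n (fun ρ : ℝ => 1 + ρ ^ 2 / ε ^ 2) := by fun_prop
  exact h.log fun ρ => (by positivity : (0 : ℝ) < 1 + ρ ^ 2 / ε ^ 2).ne'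

/-! ## §3 Concentration at the axis: no uniform modulus -/

/-- **The normalised profiles tend to `1` at every fixed radius.** For `0 < r`,
`Γ_ε(r)/Γ_ε(1) = log(1 + r²/ε²)/log(1 + 1/ε²) → 1` as `ε → 0⁺`: writing both logarithms as `log(· + ε²) − 2 log ε`,
the ratio is `1 + (log(r²+ε²) − log(1+ε²))/(log(1+ε²) − 2 log ε)` with a bounded numerator and a denominator
`→ +∞`. [folklore] -/
theorem tendsto_sinkSwirl_ratio {r : ℝ} (hr : 0 < r) :
    Tendsto (fun ε : ℝ => Real.log (1 + r ^ 2 / ε ^ 2) / Real.log (1 + 1 ^ 2 / ε ^ 2)) (𝓝[>] 0) (𝓝 1) := by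
  -- numerator → log (r²), denominator → +∞
  have hnum : Tendsto (fun ε : ℝ => Real.log (r ^ 2 + ε ^ 2) - Real.log (1 + ε ^ 2)) (𝓝[>] 0)
      (𝓝 (Real.log (r ^ 2 + 0 ^ 2) - Real.log (1 + 0 ^ 2))) := by
    have hc : ContinuousAt (fun ε : ℝ => Real.log (r ^ 2 + ε ^ 2) - Real.log (1 + ε ^ 2)) 0 := by
      have h1 : r ^ 2 + (0 : ℝ) ^ 2 ≠ 0 := by positivity
      have h2 : (1 : ℝ) + 0 ^ 2 ≠ 0 := by norm_num
      fun_prop (disch := assumption)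
    exact hc.tendsto.mono_left nhdsWithin_le_nhds
  have hden : Tendsto (fun ε : ℝ => Real.log (1 + ε ^ 2) + -2 * Real.log ε) (𝓝[>] 0) atTop := by
    have h1 : Tendsto (fun ε : ℝ => Real.log (1 + ε ^ 2)) (𝓝[>] 0) (𝓝 (Real.log (1 + 0 ^ 2))) := by
      have hc : ContinuousAt (fun ε : ℝ => Real.log (1 + ε ^ 2)) 0 := by
        have h2 : (1 : ℝ) + 0 ^ 2 ≠ 0 := by norm_num
        fun_prop (disch := assumption)
      exact hc.tendsto.mono_left nhdsWithin_le_nhds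
    have h2 : Tendsto (fun ε : ℝ => -2 * Real.log ε) (𝓝[>] 0) atTop :=
      Real.tendsto_log_nhdsGT_zero.const_mul_atBot_of_neg (by norm_num)
    exact h1.add_atTop h2
  have hq := hnum.div_atTop hden
  have hq1 : Tendsto (fun ε : ℝ => 1 + (Real.log (r ^ 2 + ε ^ 2) - Real.log (1 + ε ^ 2)) /
      (Real.log (1 + ε ^ 2) + -2 * Real.log ε)) (𝓝[>] 0) (𝓝 (1 + 0)) := tendsto_const_nhds.add hq
  rw [add_zero] at hq1
  refine hq1.congr' ?_
  have hev : ∀ᶠ ε : ℝ in 𝓝[>] 0, ε ∈ Ioo (0 : ℝ) 1 := Ioo_mem_nhdsGT one_pos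
  filter_upwards [hev] with ε hε
  have hε0 : 0 < ε := hε.1
  have hε2 : 0 < ε ^ 2 := pow_pos hε0 2
  have hlogε : Real.log ε < 0 := Real.log_neg hε0 hε.2
  have e1 : Real.log (1 + r ^ 2 / ε ^ 2) = Real.log (r ^ 2 + ε ^ 2) + -2 * Real.log ε := by
    rw [show 1 + r ^ 2 / ε ^ 2 = (r ^ 2 + ε ^ 2) / ε ^ 2 by field_simp; ring,
      Real.log_div (by positivity) hε2.ne', Real.log_pow]
    push_cast
    ring
  have e2 : Real.log (1 + 1 ^ 2 / ε ^ 2) = Real.log (1 + ε ^ 2) + -2 * Real.log ε := by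
    rw [show 1 + 1 ^ 2 / ε ^ 2 = (1 + ε ^ 2) / ε ^ 2 by field_simp; ring,
      Real.log_div (by positivity) hε2.ne', Real.log_pow]
    push_cast
    ring
  have hD : 0 < Real.log (1 + ε ^ 2) + -2 * Real.log ε := by
    have : 0 ≤ Real.log (1 + ε ^ 2) := Real.log_nonneg (by nlinarith)
    linarith
  rw [e1, e2, eq_div_iff hD.ne', add_mul, one_mul, div_mul_cancel₀ _ hD.ne']
  ring

/-- **No modulus of vanishing at the axis uniform in the core radius.** For every function `φ` with `φ(0⁺) = 0`
there are a core radius `ε > 0` and a radius `0 < r ≤ 1` at which the normalised steady profile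
`Γ_ε(r)/Γ_ε(1)` EXCEEDS `φ(r)` — although every `Γ_ε` is smooth, vanishes on the axis, is increasing with
`Γ_ε(1)/Γ_ε(1) = 1`, and solves the swirl equation for a smooth divergence-free drift obeying the one-sided gate
`r b_r > −2` (`sinkGate_bounds`, `sinkDrift_divFree`, `sinkSwirl_pde`).  In particular no Hölder rate `C r^α` and no
log modulus at the axis follows from those inputs at the critical constant `2`. [folklore] -/
theorem not_uniform_modulus {φ : ℝ → ℝ} (hφ : Tendsto φ (𝓝[>] 0) (𝓝 0)) :
    ¬ ∀ ε : ℝ, 0 < ε → ∀ r ∈ Ioc (0 : ℝ) 1,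
      Real.log (1 + r ^ 2 / ε ^ 2) / Real.log (1 + 1 ^ 2 / ε ^ 2) ≤ φ r := by
  intro H
  -- a radius `0 < r ≤ 1` with `φ r < 1/2`
  have hev : ∀ᶠ r : ℝ in 𝓝[>] 0, φ r < 1 / 2 ∧ r ∈ Ioo (0 : ℝ) 1 :=
    ((tendsto_order.1 hφ).2 _ (by norm_num)).and (Ioo_mem_nhdsGT one_pos)
  obtain ⟨r, hφr, hr⟩ := hev.exists
  -- for small `ε` the normalised profile at `r` exceeds `1/2`
  have hev2 : ∀ᶠ ε : ℝ in 𝓝[>] 0,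
      1 / 2 < Real.log (1 + r ^ 2 / ε ^ 2) / Real.log (1 + 1 ^ 2 / ε ^ 2) ∧ ε ∈ Ioo (0 : ℝ) 1 :=
    ((tendsto_order.1 (tendsto_sinkSwirl_ratio hr.1)).1 _ (by norm_num)).and (Ioo_mem_nhdsGT one_pos)
  obtain ⟨ε, hbig, hε⟩ := hev2.exists
  have h := H ε hε.1 r ⟨hr.1, hr.2.le⟩
  linarith

end Summit.NavierStokesRegularity.NavierStokesRegularity.Theorems.RadialInflowCriticalSink

end
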